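import Summits.SmoothPoincare4.SmoothPoincare4.Theorems.DottedCircleRasmussenDcrGapHelperHandlebodyChartModelHandlesInflateAux
import Summits.SmoothPoincare4.SmoothPoincare4.Theorems.DottedCircleRasmussenDcrGapHelperHandlebodyChartModelHandlesFlowPhase

/-!
# Helper `helper_handlebodyChart_modelHandles` (M3: handle structure of the model dotted handlebody `D_k`)
# of line `mk_friends` for crux `DcrGap` — inflation of the holes, part 2: the flow
(item stmt-SmoothPoincare4-16128, route route-SmoothPoincare4-DottedCircleRasmussen)

**Registered piece `helper_handlebodyChart_modelHandles_inflateFlow` of the model lemma M3.**  Third stage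
of the squeeze of part 2 of the data stub `helper_handlebodyChart_modelHandles_data`: the flow `θ` of the
outward radial field `V = χ Σ_j β(|z - c_j|²) (z - c_j, 0)` on `ℝ⁴ = ℂ²` (`β = 1` on `[0, 11/4]`, `β = 0`
beyond `14/5`; `χ = φ(G_k)` on the quarter-guard zone, `φ = 1` below `24/25`, `φ = 0` above `97/100`), smooth
and supported in the compact part `{guard ≥ 1, G_k ≤ 97/100}` of `D_k` (`ModelHandles.exists_inflate_flow`):
the flow commutes with the rotations of the `w`-plane and fixes `w`; along the orbit of a point of
`D_k ∩ {G_k ≤ 24/25}` the level `G_k` is non-increasing (on the support of the `j`-th bump `|z - c_j| < 42/25`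
and the radial derivative of the planar potential is negative, `…ModelHandlesInflateAux`), so the orbit stays
there and `χ = 1` along it; the bumps have disjoint supports, an orbit starting in the `j`-th bump never reaches
`|z - c_j|² = 14/5` (rest points), and while `|z - c_j|² ≤ 11/4` the hole term grows like `e^{2t}`: at time
`1` every hole term is `≥ 11/4`, beyond the stall layers `8/5 ≤ |z - c_j| ≤ 41/25` of the final radial flow.

No definitions, no named facts, no `sorry`.  References: J. Milnor, *Morse Theory* (1963), §3
[Milnor1963]; J. M. Lee, *Introduction to Smooth Manifolds*, 2nd ed. (2012), Thm. 9.16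
[LeeSmoothManifolds2013].
-/

-- the prescribed namespace `Summit.<P>.<Sub>.…` duplicates `SmoothPoincare4` (P = Sub)
set_option linter.dupNamespace false
set_option linter.style.longLine false

noncomputable section

open scoped Manifold ContDiff Topology ComplexConjugate
open Function Set Metric Filter
open Literature.Topology.FourManifolds Literature.Topology.FourManifolds.MMSW
open Literature.AlgebraicTopology.Homotopy.HopfFibration

namespace Summit.SmoothPoincare4.SmoothPoincare4.Theorems.DcrGap.MkFriends

namespace ModelHandles

/-- The hole terms are smooth (polynomials). [folklore] -/
theorem contDiff_holeTerm {k : ℕ} (j : Fin k) : ContDiff ℝ ∞ (holeTerm k j) := by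
  unfold holeTerm; fun_prop

/-- **Disjointness of the bumps**: within `42/25` of the hole `j` every other hole is at squared distance
`≥ 5`. [folklore] -/
theorem five_le_holeTerm_of_ne {k : ℕ} {y : EuclideanSpace ℝ (Fin 4)} {j m : Fin k}
    (hj : holeTerm k j y ≤ (42 / 25) ^ 2) (hm : m ≠ j) : 5 ≤ holeTerm k m y := by
  rw [holeTerm_eq_normSq, Complex.normSq_eq_norm_sq] at hj ⊢
  have h1 : ‖zC y - holeCentre k j‖ ≤ 42 / 25 := by
    nlinarith [norm_nonneg (zC y - holeCentre k j)]
  have h4 : (4 : ℝ) ≤ ‖holeCentre k m - holeCentre k j‖ := by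
    have e : holeCentre k m - holeCentre k j = (((4 * (((m : ℕ) : ℝ) - ((j : ℕ) : ℝ)) : ℝ)) : ℂ) := by
      simp only [holeCentre]; push_cast; ring
    rw [e, Complex.norm_real, Real.norm_eq_abs, abs_mul, abs_of_pos (by norm_num : (0 : ℝ) < 4)]
    have : (1 : ℝ) ≤ |((m : ℕ) : ℝ) - ((j : ℕ) : ℝ)| := by
      have hne : (m : ℕ) ≠ (j : ℕ) := fun h => hm (Fin.ext h)
      rcases Nat.lt_or_gt_of_ne hne with h | h
      · have h' : ((m : ℕ) : ℝ) + 1 ≤ ((j : ℕ) : ℝ) := by exact_mod_cast h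
        rw [abs_of_neg (by linarith)]; linarith
      · have h' : ((j : ℕ) : ℝ) + 1 ≤ ((m : ℕ) : ℝ) := by exact_mod_cast h
        rw [abs_of_pos (by linarith)]; linarith
    linarith
  have h2 : ‖holeCentre k m - holeCentre k j‖ ≤ ‖zC y - holeCentre k m‖ + ‖zC y - holeCentre k j‖ := by
    have := norm_sub_le (zC y - holeCentre k j) (zC y - holeCentre k m)
    rw [show zC y - holeCentre k j - (zC y - holeCentre k m) = holeCentre k m - holeCentre k j by ring] at this
    linarith
  have h3 : (58 : ℝ) / 25 ≤ ‖zC y - holeCentre k m‖ := by linarith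
  nlinarith [h3]

/-- **The inflation flow of the holes** (see the module docstring): the smooth complete flow `θ` of
`V = χ Σ_j β(|z - c_j|²) (z - c_j, 0)`, supported in the compact part `K = {guard ≥ 1, G_k ≤ 97/100}` of
`D_k`, with diffeomorphic stages commuting with the rotations of the `w`-plane and fixing `w`; orbits of
points of `D_k ∩ {G_k ≤ 24/25}` stay there (`G_k` is non-increasing along them), and at time `1` all their
hole terms are `≥ 11/4`. [folklore] -/
theorem exists_inflate_flow (k : ℕ) :
    ∃ (θ : ℝ × EuclideanSpace ℝ (Fin 4) → EuclideanSpace ℝ (Fin 4))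
      (V : EuclideanSpace ℝ (Fin 4) → EuclideanSpace ℝ (Fin 4)) (K : Set (EuclideanSpace ℝ (Fin 4))),
      ContDiff ℝ ∞ θ ∧ (∀ x, θ (0, x) = x) ∧ (∀ t s x, θ (t, θ (s, x)) = θ (t + s, x)) ∧
      (∀ x t, HasDerivAt (fun t => θ (t, x)) (V (θ (t, x))) t) ∧ Continuous V ∧
      IsCompact K ∧ K ⊆ modelHandlebody k ∧ (∀ x, x ∉ K → V x = 0) ∧ (∀ x, x ∉ K → ∀ t, θ (t, x) = x) ∧
      (∀ s, ∃ Φ : EuclideanSpace ℝ (Fin 4) ≃ₘ⟮𝓡 4, 𝓡 4⟯ EuclideanSpace ℝ (Fin 4), ∀ x, Φ x = θ (s, x)) ∧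
      (∀ u : ℂ, ‖u‖ = 1 → ∀ t x, θ (t, fibreRot (fun _ => u) x) = fibreRot (fun _ => u) (θ (t, x))) ∧
      (∀ x ∈ K, ∀ t, θ (t, x) ∈ K) ∧ (∀ y ∈ K, ∀ j : Fin k, (1 : ℝ) ≤ holeTerm k j y) ∧
      (∀ x t, wC (θ (t, x)) = wC x) ∧
      ∀ x ∈ modelHandlebody k, levelFun k x ≤ 24 / 25 →
        (∀ t, 0 ≤ t → θ (t, x) ∈ modelHandlebody k ∧ levelFun k (θ (t, x)) ≤ 24 / 25) ∧
        ∀ j, 11 / 4 ≤ holeTerm k j (θ (1, x)) := by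
  -- the cutoffs
  set φ : ℝ → ℝ := fun g => Real.smoothTransition (100 * (97 / 100 - g)) with hφ
  have hφs : ContDiff ℝ ∞ φ :=
    Real.smoothTransition.contDiff.comp (contDiff_const.mul (contDiff_const.sub contDiff_id))
  have hφ1 : ∀ g, g ≤ 24 / 25 → φ g = 1 := fun g hg => Real.smoothTransition.one_of_one_le (by linarith)
  have hφ0 : ∀ g, φ g ≠ 0 → g < 97 / 100 := fun g hg => by
    by_contra hle; push Not at hle
    exact hg (Real.smoothTransition.zero_of_nonpos (by linarith))
  set β : ℝ → ℝ := fun s => Real.smoothTransition (20 * (14 / 5 - s)) with hβ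
  have hβs : ContDiff ℝ ∞ β :=
    Real.smoothTransition.contDiff.comp (contDiff_const.mul (contDiff_const.sub contDiff_id))
  have hβ1 : ∀ s, s ≤ 11 / 4 → β s = 1 := fun s hs => Real.smoothTransition.one_of_one_le (by linarith)
  have hβ0 : ∀ s, 14 / 5 ≤ s → β s = 0 := fun s hs => Real.smoothTransition.zero_of_nonpos (by linarith)
  have hβne : ∀ s, β s ≠ 0 → s < 14 / 5 := fun s h => by
    by_contra hle; push Not at hle; exact h (hβ0 s hle)
  have hβ01 : ∀ s, 0 ≤ β s ∧ β s ≤ 1 := fun s => ⟨Real.smoothTransition.nonneg _, Real.smoothTransition.le_one _⟩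
  set χ : EuclideanSpace ℝ (Fin 4) → ℝ :=
    fun y => if ∀ j : Fin k, (1 : ℝ) / 4 < holeTerm k j y then φ (levelFun k y) else 0 with hχ
  have hpos4 : ∀ y : EuclideanSpace ℝ (Fin 4), (∀ j, (1 : ℝ) / 4 < holeTerm k j y) →
      ∀ j, 0 < holeTerm k j y := fun y h j => lt_trans (by norm_num) (h j)
  have hχne : ∀ y, χ y ≠ 0 → (∀ j, (1 : ℝ) / 4 < holeTerm k j y) ∧ levelFun k y < 97 / 100 := by
    intro y h
    simp only [hχ] at h
    split_ifs at h with h4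
    · exact ⟨h4, hφ0 _ h⟩
    · exact absurd rfl h
  have hχ01 : ∀ y, 0 ≤ χ y ∧ χ y ≤ 1 := by
    intro y
    simp only [hχ]
    split_ifs
    · exact ⟨Real.smoothTransition.nonneg _, Real.smoothTransition.le_one _⟩
    · exact ⟨le_rfl, zero_le_one⟩
  have hχeq : ∀ y, (∀ j, (1 : ℝ) / 4 < holeTerm k j y) → χ y = φ (levelFun k y) := fun y h => by
    simp only [hχ, if_pos h]
  have hχs : ContDiff ℝ ∞ χ := by
    rw [contDiff_iff_contDiffAt]
    intro y
    by_cases hy4 : ∀ j : Fin k, (1 : ℝ) / 4 < holeTerm k j y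
    · have hy0 : ∀ j, holeTerm k j y ≠ 0 := fun j => (hpos4 y hy4 j).ne'
      have hev : χ =ᶠ[𝓝 y] fun y' => φ (levelFun k y') := by
        filter_upwards [(isOpen_guard (1 / 4)).mem_nhds hy4] with y' hy'
        simp only [hχ, if_pos hy']
      exact (hφs.contDiffAt.comp y (contDiffAt_levelFun hy0)).congr_of_eventuallyEq hev
    · push Not at hy4
      obtain ⟨j, hj⟩ := hy4
      have hev : χ =ᶠ[𝓝 y] fun _ => 0 := by
        have hopen : IsOpen {y' : EuclideanSpace ℝ (Fin 4) | holeTerm k j y' < 1 / 2} :=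
          isOpen_lt (continuous_holeTerm j) continuous_const
        filter_upwards [hopen.mem_nhds (show holeTerm k j y < 1 / 2 by linarith)] with y' hy'
        by_contra h
        obtain ⟨h4, hG⟩ := hχne y' h
        have := FriendsH2.half_lt_holeTerm_of_levelFun_lt_two (hpos4 y' h4) (by linarith) j
        linarith
      exact (contDiffAt_const (c := (0 : ℝ))).congr_of_eventuallyEq hev
  -- the projection onto the `z`-plane and the lifted centres
  obtain ⟨P, hP⟩ := exists_clm_zProj
  set cpt : Fin k → EuclideanSpace ℝ (Fin 4) := fun j => ofZW (holeCentre k j) 0 with hcpt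
  have hPsub : ∀ y j, P (y - cpt j) = ofZW (zC y - holeCentre k j) 0 := by
    intro y j
    rw [map_sub, hP, hP]
    ext i
    fin_cases i <;> simp [ofZW, zC, hcpt]
  -- the field and the support set
  set V : EuclideanSpace ℝ (Fin 4) → EuclideanSpace ℝ (Fin 4) :=
    fun y => χ y • ∑ j : Fin k, β (holeTerm k j y) • P (y - cpt j) with hV
  set K : Set (EuclideanSpace ℝ (Fin 4)) := {y | (∀ j : Fin k, (1 : ℝ) ≤ holeTerm k j y) ∧
    levelFun k y ≤ 97 / 100} with hK
  have hKD : K ⊆ modelHandlebody k := fun y hy => ⟨hy.1, by linarith [hy.2]⟩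
  have hχK : ∀ y, χ y ≠ 0 → y ∈ K := by
    intro y hy
    obtain ⟨h4, hG⟩ := hχne y hy
    refine ⟨fun j => ?_, hG.le⟩
    have h := ((FriendsH2.levelFun_bounds (hpos4 y h4)).2.2 j).trans hG.le
    rw [div_le_iff₀ (hpos4 y h4 j)] at h
    nlinarith [hpos4 y h4 j]
  have hKc : IsCompact K := by
    have hKeq : K = {y : EuclideanSpace ℝ (Fin 4) | ∀ j : Fin k, (1 : ℝ) ≤ holeTerm k j y} ∩
        levelFun k ⁻¹' Iic (97 / 100) := rfl
    refine Metric.isCompact_of_isClosed_isBounded ?_ ?_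
    · rw [hKeq]
      exact (continuousOn_levelFun (by norm_num : (0 : ℝ) < 1)).preimage_isClosed_of_isClosed
        (isClosed_guard 1) isClosed_Iic
    · refine (isBounded_closedBall (x := (0 : EuclideanSpace ℝ (Fin 4)))
        (r := 40 * ((k : ℝ) + 1) + 1)).subset fun y hy => mem_closedBall_zero_iff.2 ?_
      have hpos : ∀ j, 0 < holeTerm k j y := fun j => lt_of_lt_of_le (by norm_num) (hy.1 j)
      have h1 := FriendsH2.norm_sq_le_levelFun hpos
      have h5 : ‖y‖ ^ 2 ≤ (40 * ((k : ℝ) + 1) + 1) ^ 2 := by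
        have h2 : levelFun k y * ((40 * ((k : ℝ) + 1)) ^ 2 + 1) ≤ 1 * ((40 * ((k : ℝ) + 1)) ^ 2 + 1) :=
          mul_le_mul_of_nonneg_right (by linarith [hy.2]) (by positivity)
        have hk : (0 : ℝ) ≤ k := k.cast_nonneg
        nlinarith
      exact le_of_pow_le_pow_left₀ two_ne_zero (by positivity) h5
  -- smoothness and support of the field
  have hVs : ContDiff ℝ ∞ V := by
    refine hχs.smul (ContDiff.sum fun j _ => ?_)
    exact (hβs.comp (contDiff_holeTerm j)).smul (P.contDiff.comp (contDiff_id.sub contDiff_const))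
  have hVK : ∀ y, y ∉ K → V y = 0 := by
    intro y hy
    have hχ0 : χ y = 0 := by by_contra h; exact hy (hχK y h)
    simp only [hV, hχ0, zero_smul]
  have hVzero : ∀ y, (∀ j, 14 / 5 ≤ holeTerm k j y) → V y = 0 := by
    intro y hy
    simp only [hV]
    rw [Finset.sum_eq_zero (fun j _ => by rw [hβ0 _ (hy j), zero_smul]), smul_zero]
  -- equivariance under the rotations of the `w`-plane
  have hrotfix : ∀ (u : ℂ) (z : ℂ), fibreRot (fun _ => u) (ofZW z 0) = ofZW z 0 := by
    intro u z; simp [fibreRot]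
  have hVrot : ∀ u : ℂ, ‖u‖ = 1 → ∀ (L : EuclideanSpace ℝ (Fin 4) →L[ℝ] EuclideanSpace ℝ (Fin 4)),
      (∀ y, L y = fibreRot (fun _ => u) y) → ∀ y, V (L y) = L (V y) := by
    intro u hu L hL y
    have hT : ∀ j, holeTerm k j (L y) = holeTerm k j y := fun j => by
      rw [hL]; exact holeTerm_fibreRot _ j y
    have hGy : levelFun k (L y) = levelFun k y := by
      rw [hL]; exact levelFun_fibreRot (by simpa using hu)
    have hχy : χ (L y) = χ y := by simp only [hχ, hT, hGy]
    have hPy : ∀ j, P (L y - cpt j) = P (y - cpt j) := by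
      intro j; rw [hPsub, hPsub, hL, zC_fibreRot]
    have hLP : ∀ j, L (P (y - cpt j)) = P (y - cpt j) := by
      intro j; rw [hPsub, hL, hrotfix]
    simp only [hV, hχy, hT, hPy, map_smul, map_sum, hLP]
  -- the flow package
  obtain ⟨θ, hθs, h0, hadd, hint, hfix, hfixK, hstage, hcomm⟩ := exists_flow_package hVs hKc hVK
  have horbK : ∀ x ∈ K, ∀ t, θ (t, x) ∈ K := by
    intro x hxK t
    by_contra h
    have h1 := hfixK _ h (-t)
    rw [hadd, neg_add_cancel, h0] at h1
    exact h (h1 ▸ hxK)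
  have hbar : ∀ x t, V (θ (t, x)) = 0 → θ (t, x) = x := by
    intro x t h
    have h1 := hfix _ h (-t)
    rw [hadd, neg_add_cancel, h0] at h1
    exact h1.symm
  -- `w` is constant along the flow
  obtain ⟨Lw, hLw⟩ := exists_clm_wC
  have hwV : ∀ y, wC (V y) = 0 := by
    intro y
    rw [show wC (V y) = Lw (V y) from (hLw _).symm]
    simp only [hV, map_smul, map_sum]
    rw [Finset.sum_eq_zero, smul_zero]
    intro j _
    rw [hLw, hPsub, wC_ofZW, smul_zero]
  have hwconst : ∀ x t, wC (θ (t, x)) = wC x := by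
    intro x t
    have hd : ∀ s, HasDerivAt (fun s => wC (θ (s, x))) 0 s := fun s => by
      have := hasDerivAt_wC_flow hint x s; rwa [hwV] at this
    have h := is_const_of_deriv_eq_zero (fun s => (hd s).differentiableAt) (fun s => (hd s).deriv) t 0
    simpa [h0] using h
  -- the shadow of the field
  obtain ⟨Lz, hLz⟩ := exists_clm_zC
  have hzV : ∀ y, zC (V y) = (χ y : ℂ) * ∑ j : Fin k, ((β (holeTerm k j y) : ℝ) : ℂ) * (zC y - holeCentre k j) := by
    intro y
    rw [show zC (V y) = Lz (V y) from (hLz _).symm]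
    simp only [hV, map_smul, map_sum]
    simp only [hLz, hPsub, zC_ofZW, Complex.real_smul, Finset.mul_sum]
  -- the radial derivative of `G_k` along the field is `≤ 0` on `K`
  have hGV : ∀ y ∈ K, fderiv ℝ (levelFun k) y (V y) ≤ 0 := by
    intro y hy
    have hne : ∀ j, holeTerm k j y ≠ 0 := fun j => (lt_of_lt_of_le one_pos (hy.1 j)).ne'
    simp only [hV, map_smul, map_sum, smul_eq_mul]
    refine mul_nonpos_of_nonneg_of_nonpos (hχ01 y).1 (Finset.sum_nonpos fun j _ => ?_)
    by_cases hb : β (holeTerm k j y) = 0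
    · rw [hb, zero_mul]
    · have hlt : holeTerm k j y < 14 / 5 := hβne _ hb
      have hnorm : ‖zC y - holeCentre k j‖ ≤ 42 / 25 := by
        rw [holeTerm_eq_normSq, Complex.normSq_eq_norm_sq] at hlt
        nlinarith [norm_nonneg (zC y - holeCentre k j)]
      have h := re_gradC_mul_conj_neg (zC y) j (zC_ne_holeCentre hy.1 j) hnorm
      rw [Complex.mul_re, gradC_re, gradC_im, Complex.conj_re, Complex.conj_im] at h
      simp only [Complex.sub_re, Complex.sub_im, zC_re, zC_im, holeCentre_re, holeCentre_im] at h
      have hrad : fderiv ℝ (levelFun k) y (P (y - cpt j)) ≤ 0 := by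
        rw [fderiv_levelFun_apply hne, hPsub]
        simp only [ofZW_apply0, ofZW_apply1, ofZW_apply2, ofZW_apply3, Complex.sub_re, Complex.sub_im,
          zC_re, zC_im, holeCentre_re, holeCentre_im, Complex.zero_re, Complex.zero_im]
        nlinarith [h]
      exact mul_nonpos_of_nonneg_of_nonpos (hβ01 _).1 hrad
  -- orbits of points of `D_k ∩ {G_k ≤ 24/25}`
  have hDK : ∀ x ∈ modelHandlebody k, levelFun k x ≤ 24 / 25 → x ∈ K := fun x hx hG =>
    ⟨hx.1, by linarith⟩
  refine ⟨θ, V, K, hθs, h0, hadd, hint, hVs.continuous, hKc, hKD, hVK, hfixK, fun s => ?_,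
    fun u hu t x => ?_, horbK, fun y hy => hy.1, hwconst, fun x hx hG => ?_⟩
  · obtain ⟨Φ, hΦ⟩ := hstage s
    exact ⟨Φ, hΦ⟩
  · obtain ⟨L, hL⟩ := exists_clm_fibreRot_const u
    rw [← hL, ← hL]
    exact hcomm L (hVrot u hu L hL) _ _
  have hxK := hDK x hx hG
  have horb : ∀ t, θ (t, x) ∈ K := horbK x hxK
  have hne : ∀ t j, holeTerm k j (θ (t, x)) ≠ 0 := fun t j => (lt_of_lt_of_le one_pos ((horb t).1 j)).ne'
  have hg : ∀ t, HasDerivAt (fun t => levelFun k (θ (t, x)))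
      (fderiv ℝ (levelFun k) (θ (t, x)) (V (θ (t, x)))) t := by
    intro t
    have hGd : HasFDerivAt (levelFun k) (fderiv ℝ (levelFun k) (θ (t, x))) (θ (t, x)) :=
      ((contDiffAt_levelFun (hne t)).differentiableAt (by simp)).hasFDerivAt
    exact hGd.comp_hasDerivAt t (hint x t)
  have hanti : Antitone fun t => levelFun k (θ (t, x)) :=
    antitone_of_deriv_nonpos (fun t => (hg t).differentiableAt) fun t => by
      rw [(hg t).deriv]; exact hGV _ (horb t)
  have hGt : ∀ t, 0 ≤ t → levelFun k (θ (t, x)) ≤ 24 / 25 := fun t ht => by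
    have := hanti ht; simp only [h0] at this; exact this.trans hG
  have hχ1 : ∀ t, 0 ≤ t → χ (θ (t, x)) = 1 := fun t ht => by
    rw [hχeq _ (fun j => by linarith [(horb t).1 j])]; exact hφ1 _ (hGt t ht)
  refine ⟨fun t ht => ⟨⟨(horb t).1, by linarith [hGt t ht]⟩, hGt t ht⟩, fun j => ?_⟩
  -- growth of the hole terms: rest points
  by_cases hall : ∀ m, 14 / 5 ≤ holeTerm k m x
  · rw [hfix x (hVzero x hall) 1]
    linarith [hall j]
  push Not at hall
  obtain ⟨m, hm⟩ := hall
  -- the orbit stays in the `m`-th bump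
  have hcontm : ∀ m', Continuous fun s => holeTerm k m' (θ (s, x)) := fun m' =>
    (continuous_holeTerm m').comp (hθs.continuous.comp (continuous_id.prodMk continuous_const))
  have hstay : ∀ t, 0 ≤ t → holeTerm k m (θ (t, x)) < 14 / 5 := by
    intro t ht
    by_contra hge
    push Not at hge
    obtain ⟨s, hs, hsv⟩ := intermediate_value_Icc ht (hcontm m).continuousOn
      ⟨(show holeTerm k m (θ (0, x)) ≤ 14 / 5 by rw [h0]; exact hm.le), hge⟩
    have hsv' : holeTerm k m (θ (s, x)) = 14 / 5 := hsv
    have hV0 : V (θ (s, x)) = 0 := by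
      refine hVzero _ fun m' => ?_
      by_cases hmm : m' = m
      · rw [hmm, hsv']
      · have := five_le_holeTerm_of_ne (y := θ (s, x)) (by rw [hsv']; norm_num) hmm
        linarith
    have := hbar x s hV0
    rw [this] at hsv'
    linarith
  by_cases hjm : j = m
  swap
  · have := five_le_holeTerm_of_ne (y := θ (1, x)) (by linarith [hstay 1 zero_le_one]) hjm
    linarith
  subst hjm
  -- the hole term of the active bump: `H' = 2 β(H) H` on `[0, ∞)`
  set H : ℝ → ℝ := fun s => holeTerm k j (θ (s, x)) with hH
  have hHq : ∀ s, H s = ‖zC (θ (s, x)) - holeCentre k j‖ ^ 2 := fun s => by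
    simp only [hH, holeTerm_eq_normSq, Complex.normSq_eq_norm_sq]
  have hzVt : ∀ t, 0 ≤ t → zC (V (θ (t, x))) = ((β (H t) : ℝ) : ℂ) * (zC (θ (t, x)) - holeCentre k j) := by
    intro t ht
    rw [hzV, hχ1 t ht, Complex.ofReal_one, one_mul, Finset.sum_eq_single j]
    · intro m' _ hm'
      have h5 := five_le_holeTerm_of_ne (y := θ (t, x)) (by linarith [hstay t ht]) hm'
      rw [hβ0 _ (by linarith), Complex.ofReal_zero, zero_mul]
    · intro h; exact absurd (Finset.mem_univ j) h
  have hHd : ∀ t, 0 ≤ t → HasDerivAt H (2 * (β (H t) * H t)) t := by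
    intro t ht
    have hq : HasDerivAt (fun s => zC (θ (s, x)) - holeCentre k j)
        (((β (H t) : ℝ) : ℂ) * (zC (θ (t, x)) - holeCentre k j)) t := by
      have := (hasDerivAt_zC_flow hint x t).sub_const (holeCentre k j)
      rwa [hzVt t ht] at this
    have h2 := hq.norm_sq
    have hinner : @inner ℝ ℂ _ (zC (θ (t, x)) - holeCentre k j)
        (((β (H t) : ℝ) : ℂ) * (zC (θ (t, x)) - holeCentre k j)) = β (H t) * H t := by
      rw [← Complex.real_smul, real_inner_smul_right, real_inner_self_eq_norm_sq, hHq]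
    rw [hinner] at h2
    refine h2.congr_of_eventuallyEq (Eventually.of_forall fun s => ?_)
    simp only [hHq]
  -- `H` is non-decreasing on `[0, 1]`
  have hHc : Continuous H := hcontm j
  have hmono : MonotoneOn H (Icc 0 1) := by
    refine monotoneOn_of_deriv_nonneg (convex_Icc 0 1) hHc.continuousOn (fun t ht => ?_) fun t ht => ?_
    · rw [interior_Icc] at ht
      exact (hHd t ht.1.le).differentiableAt.differentiableWithinAt
    · rw [interior_Icc] at ht
      rw [(hHd t ht.1.le).deriv]
      have h1 : 0 ≤ H t := by rw [hHq]; positivity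
      nlinarith [(hβ01 (H t)).1]
  by_contra hlt
  push Not at hlt
  -- then `β(H) = 1` on `[0, 1]` and `H(1) = e² H(0) ≥ 3`
  have hle : ∀ t ∈ Icc (0 : ℝ) 1, H t ≤ 11 / 4 := fun t ht =>
    ((hmono ht ⟨zero_le_one, le_rfl⟩ ht.2).trans hlt.le)
  have hcont : ContinuousOn (fun t => H t * Real.exp (-2 * t)) (Icc 0 1) :=
    (hHc.mul (Real.continuous_exp.comp (continuous_const.mul continuous_id))).continuousOn
  have hderiv : ∀ t ∈ Ico (0 : ℝ) 1,
      HasDerivWithinAt (fun t => H t * Real.exp (-2 * t)) 0 (Ici t) t := by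
    intro t ht
    have hb1 : β (H t) = 1 := hβ1 _ (hle t ⟨ht.1, ht.2.le⟩)
    have h1 : HasDerivAt H (2 * H t) t := by
      have := hHd t ht.1; rwa [hb1, one_mul] at this
    have h2 : HasDerivAt (fun t => Real.exp (-2 * t)) (Real.exp (-2 * t) * (-2)) t := by
      have := ((hasDerivAt_id t).const_mul (-2)).exp
      simpa using this
    have h := h1.mul h2
    have e : 2 * H t * Real.exp (-2 * t) + H t * (Real.exp (-2 * t) * -2) = 0 := by ring
    rw [e] at h
    exact h.hasDerivWithinAt
  have hconst := constant_of_has_deriv_right_zero hcont hderiv 1 ⟨zero_le_one, le_rfl⟩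
  simp only [mul_zero, Real.exp_zero, mul_one] at hconst
  have hH0 : 1 ≤ H 0 := by simp only [hH, h0]; exact hx.1 j
  have hlt' : H 1 < 11 / 4 := hlt
  have hexp : (3 : ℝ) ≤ Real.exp 2 := by
    have := Real.add_one_le_exp (2 : ℝ); linarith
  have hpos : 0 < Real.exp (-2 : ℝ) := Real.exp_pos _
  have hprod : Real.exp (-2 : ℝ) * Real.exp 2 = 1 := by
    rw [← Real.exp_add]; norm_num
  -- `H 1 * exp(-2) = H 0 ≥ 1` while `H 1 < 11/4 < 3 ≤ exp 2`
  have h1 : (1 : ℝ) < 11 / 4 * Real.exp (-2) := by nlinarith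
  nlinarith [mul_lt_mul_of_pos_right h1 (Real.exp_pos 2), hprod, hexp]

end ModelHandles

/-- **Registered piece `helper_handlebodyChart_modelHandles_inflateFlow` of the model lemma M3 (the inflation
flow of the holes)**: `ModelHandles.exists_inflate_flow`, fully quantified. [folklore] -/
theorem helper_handlebodyChart_modelHandles_inflateFlow : ∀ (k : ℕ), ∃ (θ : ℝ × EuclideanSpace ℝ (Fin 4) → EuclideanSpace ℝ (Fin 4)) (V : EuclideanSpace ℝ (Fin 4) → EuclideanSpace ℝ (Fin 4)) (K : Set (EuclideanSpace ℝ (Fin 4))), ContDiff ℝ ((⊤ : ℕ∞) : WithTop ℕ∞) θ ∧ (∀ x, θ (0, x) = x) ∧ (∀ t s x, θ (t, θ (s, x)) = θ (t + s, x)) ∧ (∀ x t, HasDerivAt (fun t => θ (t, x)) (V (θ (t, x))) t) ∧ Continuous V ∧ IsCompact K ∧ K ⊆ Literature.Topology.FourManifolds.MMSW.modelHandlebody k ∧ (∀ x, x ∉ K → V x = 0) ∧ (∀ x, x ∉ K → ∀ t, θ (t, x) = x) ∧ (∀ s, ∃ Φ : EuclideanSpace ℝ (Fin 4) ≃ₘ⟮𝓡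 4, 𝓡 4⟯ EuclideanSpace ℝ (Fin 4), ∀ x, Φ x = θ (s, x)) ∧ (∀ u : ℂ, ‖u‖ = 1 → ∀ t x, θ (t, Literature.Topology.FourManifolds.MMSW.fibreRot (fun _ => u) x) = Literature.Topology.FourManifolds.MMSW.fibreRot (fun _ => u) (θ (t, x))) ∧ (∀ x ∈ K, ∀ t, θ (t, x) ∈ K) ∧ (∀ y ∈ K, ∀ j : Fin k, (1 : ℝ) ≤ Literature.Topology.FourManifolds.MMSW.holeTerm k j y) ∧ (∀ x t, Literature.AlgebraicTopology.Homotopy.HopfFibration.wC (θ (t, x)) = Literature.AlgebraicTopology.Homotopy.HopfFibration.wC x) ∧ ∀ x ∈ Literature.Topology.FourManifolds.MMSW.modelHandlebody k, Literature.Topology.FourManifolds.MMSW.levelFun k x ≤ 24 / 25 → (∀ t : ℝ, 0 ≤ t → θ (t, x) ∈ Literature.Topology.FourManifolds.MMSW.modelHandlebody k ∧ Literature.Topology.FourManifolds.MMSW.levelFun k (θ (t, x)) ≤ 24 / 25) ∧ ∀ j, 11 / 4 ≤ Literature.Topology.FourManifolds.MMSW.holeTerm k j (θ (1, x)) :=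
  fun k => ModelHandles.exists_inflate_flow k

end Summit.SmoothPoincare4.SmoothPoincare4.Theorems.DcrGap.MkFriends

end
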